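import Summits.Ventures.CertifiedArithmetic.LowPrec.SRAccumulationOptimal
import HarnessLib

/-!
# Stochastic rounding in low-precision formats LXVII — THE CORRIDOR-FREE OPTIMALITY OF RECURSIVE SR

HONEST FRAMING: certified error envelopes and provably optimal rounding/accumulation schemes for
low-precision formats under stated cost models; every table by two implementations; no hardware or
vendor claims.

File LXVI (`LowPrec/SRAccumulationOptimal`, `accExp_le_exp`) proves that recursive SR minimises
`E f(ŝₙ)` for every convex `f` among the schemes admissible for a DECLARED no-saturation corridor.
Here the corridor hypothesis is removed altogether: let `AdmU F x n s T` say only that the scheme `T`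
(an outcome tree of depth `n`) uses, at every node it reaches, a probability vector on `F` whose mean
is the current state plus the next summand — conditional unbiasedness at every step, supports
ANYWHERE in `F`, arbitrary dependence on the history.  Then (`accExp_le_exp_of_admU`)

  `AdmU F x n s T → accExp F x n f s ≤ T.exp F f s`   for every convex `f`,

with NO further hypothesis: the mere existence of an everywhere-unbiased competitor forces SR to be
saturation-free (`AdmU.noSat`); conversely SR is such a competitor whenever it is saturation-free, so
`(∃ T, AdmU F x n s T) ↔ NoSat F x n s` and on that event `accExp F x n f s = min_T E_T f(ŝₙ)` — the
attainment half and the FP4 ledger are in the companion file `LowPrec/SRAccumulationOptimalFreeLedger`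
(`srScheme_admU`, `exists_admU_iff_noSat`, `exists_admU_exp_eq_accExp`).

The proof constructs the CANONICAL (widest) corridor from the data alone — the feasibility envelopes
`envLo`/`envHi` (backward recursion: at the last level the whole of `F`; one level up, the least /
greatest point of `F` from which the next window is reachable without bias) — and shows (i) they form
a `Corridor` as soon as one grid point is feasible and (ii) a grid point is SR-feasible iff it lies in
the level-0 envelope window (`env_spec`), (iii) every `AdmU` scheme is `Adm` for the envelope corridor
(`AdmU.adm_env`).  File LXVI is then applied to the CHILDREN of the root (grid starts), and the root
step — whose start `s` need not be a grid point, so that NO corridor in the sense of file LXVI need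
contain it (`F = {0, 10}`, `s = 5`, `x = (5, −10)`: SR goes `5 ↦ 10 ↦ 0` surely, yet `b₀ ∈ F`,
`b₀ ≥ 5` forces `b₀ = 10` and then `b₁ ≥ b₀ + x₀ = 15 > max F`) — is compared directly with
`step_le_law_of_subgradOn`.  `AdmU` is decidable (`instDecidableAdmU`, Boolean mirror `admUB`).
-/

namespace Summit.Ventures.CertifiedArithmetic.LowPrec.SR

open Literature.ComputerArithmetic.ConnollyHighamMary2021
open Finset

variable {K : Type*} [Field K] [LinearOrder K] [IsStrictOrderedRing K]

/-! ### Everywhere-admissible schemes -/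

/-- `AdmU F x n s T`: the scheme `T` has depth exactly `n` and at every node it reaches (state `t`,
next summand `xᵢ`) its law is a probability vector on `F` with mean `t + xᵢ`; supports are
unrestricted.  (The corridor-free version of `Adm`.) -/
def AdmU (F : Finset K) : (ℕ → K) → ℕ → K → Scheme K → Prop
  | _, 0, _, .leaf => True
  | _, 0, _, .node _ _ => False
  | _, _ + 1, _, .leaf => False
  | x, n + 1, s, .node w ch =>
      (∀ y ∈ F, 0 ≤ w y) ∧ (∑ y ∈ F, w y) = 1 ∧ (∑ y ∈ F, w y * y) = s + x 0 ∧
        ∀ y ∈ F, w y ≠ 0 → AdmU F (fun i => x (i + 1)) n y (ch y)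

omit [IsStrictOrderedRing K] in
/-- Admissible for some corridor ⇒ everywhere-admissible. -/
theorem Adm.admU {F : Finset K} :
    ∀ (n : ℕ) (a b x : ℕ → K) (s : K) (T : Scheme K), Adm F a b x n s T → AdmU F x n s T
  | 0, _, _, _, _, .leaf, _ => trivial
  | 0, _, _, _, _, .node _ _, h => h.elim
  | _ + 1, _, _, _, _, .leaf, h => h.elim
  | n + 1, a, b, x, s, .node w ch, h => by
      obtain ⟨hw, h1, hm, -, hch⟩ := h
      exact ⟨hw, h1, hm, fun y hy hy0 => Adm.admU n _ _ _ y (ch y) (hch y hy hy0)⟩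

/-! ### Two elementary facts about laws -/

/-- The mean of a law supported on `{y : lo ≤ y}` is `≥ lo`. -/
theorem law_mean_ge {F : Finset K} {w : K → K} (hw : ∀ y ∈ F, 0 ≤ w y) (h1 : ∑ y ∈ F, w y = 1)
    {lo : K} (hsupp : ∀ y ∈ F, w y ≠ 0 → lo ≤ y) : lo ≤ ∑ y ∈ F, w y * y := by
  calc lo = ∑ y ∈ F, w y * lo := by rw [← sum_mul, h1, one_mul]
    _ ≤ ∑ y ∈ F, w y * y := by
        refine sum_le_sum fun y hy => ?_
        rcases eq_or_ne (w y) 0 with h0 | h0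
        · simp [h0]
        · exact mul_le_mul_of_nonneg_left (hsupp y hy h0) (hw y hy)

/-- The mean of a law supported on `{y : y ≤ hi}` is `≤ hi`. -/
theorem law_mean_le {F : Finset K} {w : K → K} (hw : ∀ y ∈ F, 0 ≤ w y) (h1 : ∑ y ∈ F, w y = 1)
    {hi : K} (hsupp : ∀ y ∈ F, w y ≠ 0 → y ≤ hi) : ∑ y ∈ F, w y * y ≤ hi := by
  calc ∑ y ∈ F, w y * y ≤ ∑ y ∈ F, w y * hi := by
        refine sum_le_sum fun y hy => ?_
        rcases eq_or_ne (w y) 0 with h0 | h0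
        · simp [h0]
        · exact mul_le_mul_of_nonneg_left (hsupp y hy h0) (hw y hy)
    _ = hi := by rw [← sum_mul, h1, one_mul]

omit [IsStrictOrderedRing K] in
/-- A probability vector has a support point. -/
theorem law_exists_ne_zero {F : Finset K} {w : K → K} (h1 : ∑ y ∈ F, w y = 1) :
    ∃ y ∈ F, w y ≠ 0 := by
  by_contra h
  push Not at h
  rw [sum_eq_zero h] at h1
  exact zero_ne_one h1

/-! ### The feasibility envelopes (the canonical corridor) -/

/-- Lower feasibility envelope of the `n`-step problem with summands `x`, as a function of the
level `i ≤ n`: at the last level `min F`; the level-`0` value of an `(n+1)`-step problem is the least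
grid point `≥ (level-0 value of the tail problem) − x₀`; deeper levels are those of the tail. -/
def envLo (F : Finset K) (hF : F.Nonempty) : (ℕ → K) → ℕ → ℕ → K
  | _, 0, _ => F.min' hF
  | x, n + 1, 0 => up F (envLo F hF (fun i => x (i + 1)) n 0 - x 0)
  | x, n + 1, i + 1 => envLo F hF (fun i => x (i + 1)) n i

/-- Upper feasibility envelope (mirror image of `envLo`). -/
def envHi (F : Finset K) (hF : F.Nonempty) : (ℕ → K) → ℕ → ℕ → K
  | _, 0, _ => F.max' hF
  | x, n + 1, 0 => dn F (envHi F hF (fun i => x (i + 1)) n 0 - x 0)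
  | x, n + 1, i + 1 => envHi F hF (fun i => x (i + 1)) n i

omit [Field K] [IsStrictOrderedRing K] in
/-- Below the top of `F`, `up` rounds upward. -/
theorem le_up_of_le_max' {F : Finset K} (hF : F.Nonempty) {c : K} (hc : c ≤ F.max' hF) :
    c ≤ up F c := by
  rcases le_or_gt (F.min' hF) c with h | h
  · exact le_up_of_inHull ⟨⟨_, F.min'_mem hF, h⟩, ⟨_, F.max'_mem hF, hc⟩⟩
  · exact (h.trans_le (F.min'_le _ (up_mem hF c))).le

omit [Field K] [IsStrictOrderedRing K] in
/-- Above the bottom of `F`, `dn` rounds downward. -/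
theorem dn_le_of_min'_le {F : Finset K} (hF : F.Nonempty) {c : K} (hc : F.min' hF ≤ c) :
    dn F c ≤ c := by
  rcases le_or_gt c (F.max' hF) with h | h
  · exact dn_le_of_inHull ⟨⟨_, F.min'_mem hF, hc⟩, ⟨_, F.max'_mem hF, h⟩⟩
  · exact ((F.le_max' _ (dn_mem hF c)).trans_lt h).le

/-- THE ENVELOPE THEOREM.  If one grid point is SR-feasible for the `n`-step problem, then the
envelopes form a `Corridor` and a grid point is SR-feasible iff it lies in the level-0 window. -/
theorem env_spec {F : Finset K} (hF : F.Nonempty) :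
    ∀ (n : ℕ) (x : ℕ → K), (∃ y ∈ F, NoSat F x n y) →
      Corridor F (envLo F hF x n) (envHi F hF x n) x n ∧
        ∀ y ∈ F, (NoSat F x n y ↔ envLo F hF x n 0 ≤ y ∧ y ≤ envHi F hF x n 0)
  | 0, x, _ => by
      refine ⟨⟨fun i _ => F.min'_mem hF, fun i _ => F.max'_mem hF, fun i hi => absurd hi (by omega),
        fun i hi => absurd hi (by omega)⟩, fun y hy => ?_⟩
      simp only [NoSat, envLo, envHi, true_iff]
      exact ⟨F.min'_le y hy, F.le_max' y hy⟩
  | n + 1, x, hex => by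
      obtain ⟨y₀, hy₀, hN₀⟩ := hex
      -- the tail problem is feasible from the lower SR child of `y₀`
      have hN₀' := hN₀
      simp only [NoSat] at hN₀'
      obtain ⟨hin₀, hup₀, hdn₀⟩ := hN₀'
      set x' : ℕ → K := fun i => x (i + 1) with hx'
      obtain ⟨hC', hiff'⟩ := env_spec hF n x' ⟨_, dn_mem hF _, hdn₀⟩
      set lo' := envLo F hF x' n with hlo'
      set hi' := envHi F hF x' n with hhi'
      have hlo0 : envLo F hF x (n + 1) 0 = up F (lo' 0 - x 0) := rfl
      have hhi0 : envHi F hF x (n + 1) 0 = dn F (hi' 0 - x 0) := rfl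
      have hloS : ∀ i, envLo F hF x (n + 1) (i + 1) = lo' i := fun i => rfl
      have hhiS : ∀ i, envHi F hF x (n + 1) (i + 1) = hi' i := fun i => rfl
      -- the feasible point y₀ pins the envelopes on the honest side of the clamps
      have hdn_in := (hiff' _ (dn_mem hF _)).1 hdn₀
      have hup_in := (hiff' _ (up_mem hF _)).1 hup₀
      have h_lo'x : lo' 0 - x 0 ≤ F.max' hF := by
        have : lo' 0 ≤ y₀ + x 0 := hdn_in.1.trans (dn_le_of_inHull hin₀)
        linarith [F.le_max' y₀ hy₀]
      have h_hi'x : F.min' hF ≤ hi' 0 - x 0 := by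
        have : y₀ + x 0 ≤ hi' 0 := (le_up_of_inHull hin₀).trans hup_in.2
        linarith [F.min'_le y₀ hy₀]
      have hlo_ge : lo' 0 - x 0 ≤ envLo F hF x (n + 1) 0 := hlo0 ▸ le_up_of_le_max' hF h_lo'x
      have hhi_le : envHi F hF x (n + 1) 0 ≤ hi' 0 - x 0 := hhi0 ▸ dn_le_of_min'_le hF h_hi'x
      refine ⟨⟨?_, ?_, ?_, ?_⟩, fun y hy => ⟨fun hN => ?_, fun hw => ?_⟩⟩
      · rintro (_ | i) hi
        · exact hlo0 ▸ up_mem hF _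
        · exact (hloS i) ▸ hC'.lo_mem i (by omega)
      · rintro (_ | i) hi
        · exact hhi0 ▸ dn_mem hF _
        · exact (hhiS i) ▸ hC'.hi_mem i (by omega)
      · rintro (_ | i) hi
        · show lo' 0 ≤ envLo F hF x (n + 1) 0 + x 0
          linarith
        · show lo' (i + 1) ≤ lo' i + x' i
          exact hC'.lo_step i (by omega)
      · rintro (_ | i) hi
        · show envHi F hF x (n + 1) 0 + x 0 ≤ hi' 0
          linarith
        · show hi' i + x' i ≤ hi' (i + 1)
          exact hC'.hi_step i (by omega)
      · -- feasible ⇒ inside the window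
        simp only [NoSat] at hN
        obtain ⟨hin, hup, hdn⟩ := hN
        have h1 := ((hiff' _ (dn_mem hF _)).1 hdn).1.trans (dn_le_of_inHull hin)
        have h2 := (le_up_of_inHull hin).trans ((hiff' _ (up_mem hF _)).1 hup).2
        exact ⟨hlo0 ▸ up_le_of_mem hy (by linarith), hhi0 ▸ le_dn_of_mem hy (by linarith)⟩
      · -- inside the window ⇒ feasible
        obtain ⟨h1, h2⟩ := hw
        have hc1 : lo' 0 ≤ y + x 0 := by linarith
        have hc2 : y + x 0 ≤ hi' 0 := by linarith
        have hlo'm : lo' 0 ∈ F := hC'.lo_mem 0 (by omega)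
        have hhi'm : hi' 0 ∈ F := hC'.hi_mem 0 (by omega)
        have hin : InHull F (y + x 0) := ⟨⟨_, hlo'm, hc1⟩, ⟨_, hhi'm, hc2⟩⟩
        simp only [NoSat]
        refine ⟨hin, (hiff' _ (up_mem hF _)).2 ⟨?_, up_le_of_mem hhi'm hc2⟩,
          (hiff' _ (dn_mem hF _)).2 ⟨le_dn_of_mem hlo'm hc1, ?_⟩⟩
        · exact hc1.trans (le_up_of_inHull hin)
        · exact (dn_le_of_inHull hin).trans hc2

/-- An everywhere-admissible competitor exists only where SR is saturation-free. -/
theorem AdmU.noSat {F : Finset K} :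
    ∀ (n : ℕ) (x : ℕ → K) (s : K) (T : Scheme K), AdmU F x n s T → NoSat F x n s
  | 0, _, _, _, _ => trivial
  | _ + 1, _, _, .leaf, h => h.elim
  | n + 1, x, s, .node w ch, h => by
      obtain ⟨hw, h1, hm, hch⟩ := h
      have hfeas : ∀ y ∈ F, w y ≠ 0 → NoSat F (fun i => x (i + 1)) n y :=
        fun y hy hy0 => AdmU.noSat n _ y (ch y) (hch y hy hy0)
      obtain ⟨y₀, hy₀, hw₀⟩ := law_exists_ne_zero h1
      have hF : F.Nonempty := ⟨y₀, hy₀⟩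
      obtain ⟨hC', hiff'⟩ := env_spec hF n (fun i => x (i + 1)) ⟨y₀, hy₀, hfeas y₀ hy₀ hw₀⟩
      have hlo'm := hC'.lo_mem 0 (by omega)
      have hhi'm := hC'.hi_mem 0 (by omega)
      have hc1 : envLo F hF (fun i => x (i + 1)) n 0 ≤ s + x 0 :=
        hm ▸ law_mean_ge hw h1 fun y hy hy0 => ((hiff' y hy).1 (hfeas y hy hy0)).1
      have hc2 : s + x 0 ≤ envHi F hF (fun i => x (i + 1)) n 0 :=
        hm ▸ law_mean_le hw h1 fun y hy hy0 => ((hiff' y hy).1 (hfeas y hy hy0)).2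
      have hin : InHull F (s + x 0) := ⟨⟨_, hlo'm, hc1⟩, ⟨_, hhi'm, hc2⟩⟩
      simp only [NoSat]
      refine ⟨hin, (hiff' _ (up_mem hF _)).2 ⟨?_, up_le_of_mem hhi'm hc2⟩,
        (hiff' _ (dn_mem hF _)).2 ⟨le_dn_of_mem hlo'm hc1, ?_⟩⟩
      · exact hc1.trans (le_up_of_inHull hin)
      · exact (dn_le_of_inHull hin).trans hc2

/-- Every everywhere-admissible scheme is admissible for the envelope corridor. -/
theorem AdmU.adm_env {F : Finset K} (hF : F.Nonempty) :
    ∀ (n : ℕ) (x : ℕ → K) (s : K) (T : Scheme K),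
      AdmU F x n s T → Adm F (envLo F hF x n) (envHi F hF x n) x n s T
  | 0, _, _, .leaf, _ => trivial
  | 0, _, _, .node _ _, h => h.elim
  | _ + 1, _, _, .leaf, h => h.elim
  | n + 1, x, s, .node w ch, h => by
      obtain ⟨hw, h1, hm, hch⟩ := h
      have hwin : ∀ y ∈ F, w y ≠ 0 →
          envLo F hF x (n + 1) 1 ≤ y ∧ y ≤ envHi F hF x (n + 1) 1 := by
        intro y hy hy0
        have hN := AdmU.noSat n _ y (ch y) (hch y hy hy0)
        exact ((env_spec hF n (fun i => x (i + 1)) ⟨y, hy, hN⟩).2 y hy).1 hN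
      exact ⟨hw, h1, hm, hwin, fun y hy hy0 => AdmU.adm_env hF n _ y (ch y) (hch y hy hy0)⟩

/-! ### The corridor-free optimality theorem -/

/-- RECURSIVE SR IS OPTIMAL AMONG ALL EVERYWHERE-UNBIASED SCHEMES, with no further hypothesis:
if `T` is an adapted, arbitrarily randomised `F`-valued scheme that is conditionally unbiased at
every step it takes, then `E_SR f(ŝₙ) ≤ E_T f(ŝₙ)` for every convex `f`. -/
theorem accExp_le_exp_of_admU {F : Finset K} {f : K → K} (hf : ConvexOn K Set.univ f) :
    ∀ (n : ℕ) (x : ℕ → K) (s : K) (T : Scheme K), AdmU F x n s T →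
      accExp F x n f s ≤ T.exp F f s
  | 0, _, _, .leaf, _ => le_rfl
  | 0, _, _, .node _ _, h => h.elim
  | _ + 1, _, _, .leaf, h => h.elim
  | n + 1, x, s, .node w ch, h => by
      obtain ⟨hw, h1, hm, hch⟩ := h
      obtain ⟨y₀, hy₀, hw₀⟩ := law_exists_ne_zero h1
      have hF : F.Nonempty := ⟨y₀, hy₀⟩
      set x' : ℕ → K := fun i => x (i + 1) with hx'
      have hfeas : ∀ y ∈ F, w y ≠ 0 → NoSat F x' n y :=
        fun y hy hy0 => AdmU.noSat n _ y (ch y) (hch y hy hy0)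
      obtain ⟨hC', hiff'⟩ := env_spec hF n x' ⟨y₀, hy₀, hfeas y₀ hy₀ hw₀⟩
      have hwin : ∀ y ∈ F, w y ≠ 0 → envLo F hF x' n 0 ≤ y ∧ y ≤ envHi F hF x' n 0 :=
        fun y hy hy0 => (hiff' y hy).1 (hfeas y hy hy0)
      have hc1 : envLo F hF x' n 0 ≤ s + x 0 := hm ▸ law_mean_ge hw h1 fun y hy hy0 => (hwin y hy hy0).1
      have hc2 : s + x 0 ≤ envHi F hF x' n 0 := hm ▸ law_mean_le hw h1 fun y hy hy0 => (hwin y hy hy0).2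
      -- each child is beaten by SR started at the child's state (file LXVI on the envelope corridor)
      have hchild : ∀ y ∈ F, w y ≠ 0 → accExp F x' n f y ≤ (ch y).exp F f y := fun y hy hy0 =>
        accExp_le_exp hf n _ _ x' y (ch y) hC' (hwin y hy hy0).1 (hwin y hy hy0).2
          (AdmU.adm_env hF n x' y (ch y) (hch y hy hy0))
      -- the root step: SR's interpolation is below every law with the same mean
      calc accExp F x (n + 1) f s = step F (s + x 0) (fun t => accExp F x' n f t) := rfl
        _ ≤ ∑ y ∈ F, w y * accExp F x' n f y :=
            step_le_law_of_subgradOn (hC'.lo_mem 0 (by omega)) (hC'.hi_mem 0 (by omega))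
              (subgradOn_accExp hf n _ _ x' hC') hw h1 hm hc1 hc2 hwin
        _ ≤ ∑ y ∈ F, w y * (ch y).exp F f y := by
            refine sum_le_sum fun y hy => ?_
            rcases eq_or_ne (w y) 0 with h0 | h0
            · simp [h0]
            · exact mul_le_mul_of_nonneg_left (hchild y hy h0) (hw y hy)
        _ = (Scheme.node w ch).exp F f s := rfl

/-- Error form: SR minimises every convex loss of the final error `ŝₙ − sₙ` among all
everywhere-unbiased schemes. -/
theorem accExp_err_le_exp_err_of_admU {F : Finset K} {f : K → K} (hf : ConvexOn K Set.univ f)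
    {n : ℕ} {x : ℕ → K} {s : K} {T : Scheme K} (hA : AdmU F x n s T) :
    accExp F x n (fun t => f (t - (s + ∑ i ∈ range n, x i))) s ≤
      T.exp F (fun t => f (t - (s + ∑ i ∈ range n, x i))) s :=
  accExp_le_exp_of_admU (convexOn_comp_sub hf _) n x s T hA

/-- Variance form: no everywhere-unbiased scheme has smaller mean-square error than recursive SR. -/
theorem accVar_le_exp_sq_of_admU {F : Finset K} {n : ℕ} {x : ℕ → K} {s : K} {T : Scheme K}
    (hA : AdmU F x n s T) :
    accVar F x n s ≤ T.exp F (fun t => (t - (s + ∑ i ∈ range n, x i)) ^ 2) s := by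
  rw [← accExp_sq_sub_sum F x n s (AdmU.noSat n x s T hA)]
  exact accExp_le_exp_of_admU (convexOn_sq_sub _) n x s T hA

/-! ### Decidability -/

/-- Boolean mirror of `AdmU` for kernel evaluation. -/
def admUB (F : Finset K) : (ℕ → K) → ℕ → K → Scheme K → Bool
  | _, 0, _, .leaf => true
  | _, 0, _, .node _ _ => false
  | _, _ + 1, _, .leaf => false
  | x, n + 1, s, .node w ch =>
      decide (∀ y ∈ F, 0 ≤ w y) && decide ((∑ y ∈ F, w y) = 1) &&
        decide ((∑ y ∈ F, w y * y) = s + x 0) &&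
          decide (∀ y ∈ F, w y ≠ 0 → admUB F (fun i => x (i + 1)) n y (ch y) = true)

omit [IsStrictOrderedRing K] in
/-- `admUB` computes `AdmU`. -/
theorem admUB_iff (F : Finset K) : ∀ (n : ℕ) (x : ℕ → K) (s : K) (T : Scheme K),
    admUB F x n s T = true ↔ AdmU F x n s T
  | 0, _, _, .leaf => by simp [admUB, AdmU]
  | 0, _, _, .node _ _ => by simp [admUB, AdmU]
  | _ + 1, _, _, .leaf => by simp [admUB, AdmU]
  | n + 1, x, s, .node w ch => by
      simp only [admUB, AdmU, Bool.and_eq_true, decide_eq_true_eq, and_assoc]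
      have ih : ∀ y, admUB F (fun i => x (i + 1)) n y (ch y) = true ↔
          AdmU F (fun i => x (i + 1)) n y (ch y) := fun y => admUB_iff F n _ y (ch y)
      simp only [ih]

/-- `AdmU` is decidable (kernel-evaluable on literal schemes). -/
instance instDecidableAdmU (F : Finset K) (x : ℕ → K) (n : ℕ) (s : K) (T : Scheme K) :
    Decidable (AdmU F x n s T) :=
  decidable_of_iff _ (admUB_iff F n x s T)

end Summit.Ventures.CertifiedArithmetic.LowPrec.SR
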